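import Summits.BirchSwinnertonDyer.BirchSwinnertonDyer.Theorems.CongruentShaFreeCutSelmerRelaxationUniform
import Summits.BirchSwinnertonDyer.BirchSwinnertonDyer.Theorems.CongruentShaFreeCutSelmerRankOneLevelwise
import Literature.NumberTheory.EllipticCurves.Kato2004.DescentCokernelFiniteOfRankLeOneProofs
import Literature.NumberTheory.EllipticCurves.HeegnerModuleIndex
import Mathlib.Topology.MetricSpace.Basic

set_option linter.dupNamespace false
set_option autoImplicit false

/-! # Route `CongruentShaFreeCut` (rung S2) — crux `AnalyticRankOneOfRankOneFiniteShaTwo`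
(stmt-BirchSwinnertonDyer-19080): (R1) «rank one ∧ `Ш[p^∞]` finite ⇒ `rank_{ℤ_p} H¹(ℤ[1/p], T_pW) ≤ 1»
PROVED, hence the RI conjunct `Kato2004.finite_descentCokernel_of_rankOne` of the registered
`kato-zeta-perrin-riou` v1e lines ⟸ `Kato2004.nonempty_iwasawaH2Data` ∧ `Kato2004.thm12_4` (tree theorems
otherwise)

Cell `bsd-cn100`, prover seat `bsd-cn100-s2-c3` g11 (plan g18 RULING-2 (2): (R1) is s2-c3's lane).  Supports,
does not close, stmt-BirchSwinnertonDyer-19080; the final theorem is `W,p`-generic and serves the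
token-identical RI conjunct of stmt-BirchSwinnertonDyer-19160 verbatim.  Theorems only (no definition, no
named fact, no `sorry`).

## Contents (part 3 of 3)

* parts 1–2 (imported): `CongruentShaFreeCutSelmerRelaxationUniform` (ONE `N ≠ 0` with
  `N • H¹_{𝓛,⊤ at p} ⊆ Sel` at every level `p^{k+1}`, the easy half of Poitou–Tate) and
  `CongruentShaFreeCutSelmerRankOneLevelwise` (rank-one Selmer classes are integer multiples of one Kummer class up
  to ONE `B ≠ 0`; integral classes reduce into the local conditions away from `p` up to ONE `T ≠ 0`);
  here first `exists_uniform_nsmul_mem_selmerGroup_of_local` (part 1 transported to the `(p : ℤ)^{k+1}` level).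
* §4 **`rank_integralH1_top_le_one` / `rank_integralH1_layerZero_le_one`** — (R1): for `rank_ℤ W(ℚ) = 1` and
  `Ш(W)[p^∞]` finite, `Module.rank ℤ_[p] (integralH1 (tateRep W p) p ⊤) ≤ 1` (and at the bottom layer of
  any `ℤ_p`-extension).  Proof (`exists_smul_add_smul_eq_zero_of_mem_integralH1`): the reductions of
  `M • x`, `M • y` are integer multiples of one Kummer class at every level; divisibility is total in
  `ℤ_p`, the admissible multipliers form closed decreasing subsets of the compact `ℤ_p`, and a class of
  `H¹(⊤, T_pW)` with all reductions zero is zero (Rubin App. B Prop. B.2.3, tree theorem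
  `eq_zero_of_forall_reduceH1Pk_eq_zero`) — so any two integral classes are `ℤ_p`-dependent.
* §5 **`finite_descentCokernel_of_rankOne_of_nonempty_of_thm12_4`**:
  `finite_descentCokernel_of_rankOne ⟸ nonempty_iwasawaH2Data ∧ thm12_4`, by the seat's Literature
  reduction `Kato2004.finite_descentCokernel_of_rankOne_of_rank_le_one` (p501874) with (R1) discharged;
  and the (α)-door form `…_of_forall_isTopGenerator_of_thm12_4`.

HONEST FRAMING: Galois-cohomology bookkeeping over tree theorems; no named fact is introduced; the two
remaining inputs of §5 are the citation-borne Kato conjuncts (14.14.1)-injectivity and Thm. 12.4 of the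
same stub; nothing about the Perrin-Riou formula, crux B, the leaf or BSD is proved.  PARTITION: none —
RANK axis.

References: [JetchevSkinnerWan2017] Prop. 3.2.1; [MilneADT2006] I Cor. 2.3, Thm. 2.8, Lemma 3.3,
Thm. 4.10(b); [SilvermanAEC2009] VII.6.3, VIII.§2, X.§4; [Rubin2000] App. B Prop. B.2.3;
[Kato2004Asterisque] §14.14 (14.14.1), Thm. 12.4, §14.9 (14.9.3), 14.13; [Skinner2020] §2.2;
[PerrinRiou1987BSMF] §0. -/

noncomputable section

open scoped Classical NumberField

namespace Summit.BirchSwinnertonDyer.BirchSwinnertonDyer.Theorems.CongruentShaFreeCutIntegralH1RankLeOne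

open CategoryTheory Field IsDedekindDomain NumberField Function
open WeierstrassCurve (geomPoints geomTorsion galH1Torsion selmerLocalKer selmerGroup torsionPoints
  torsionGaloisModule kummerMapTorsion kummerMapTorsion_mem_selmerLocalKer)
open Literature.NumberTheory.GaloisRepresentations Literature.NumberTheory.GaloisCohomology
open Literature.NumberTheory.EllipticCurves Literature.NumberTheory.EllipticCurves.Kato2004
open Literature.NumberTheory.EllipticCurves.Kato2004.EulerSystemValues
open Summit.BirchSwinnertonDyer.Rank1Residual.X11b
open Summit.BirchSwinnertonDyer.BirchSwinnertonDyer.Theorems.CongruentShaFreeCutTwoAdicSelmerLocIndex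

open Summit.BirchSwinnertonDyer.BirchSwinnertonDyer.Theorems.CongruentShaFreeCutSelmerRelaxationUniform

open Summit.BirchSwinnertonDyer.BirchSwinnertonDyer.Theorems.CongruentShaFreeCutSelmerRankOneLevelwise

/-! ## §3 (continued) The uniform Selmer exponent at the levels `(p : ℤ)^{k+1}` -/

section Local

variable (W : WeierstrassCurve ℚ) [W.IsElliptic] (p : ℕ) [Fact p.Prime]

/-- **Rank one: the uniform Selmer exponent in `(p : ℤ)^{k+1}` currency.**  If `rank_ℤ W(ℚ) = 1` there is
`N ≠ 0` such that a class of `H¹(ℚ, W[p^{k+1}])` satisfying the Selmer local condition at every finite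
`v ≠ p` and every infinite place satisfies `N • c ∈ Sel^{(p^{k+1})}(W/ℚ)` — §1 transported along
`((p^{k+1} : ℕ) : ℤ) = (p : ℤ)^{k+1}` (the level indexes the types).
[cite: JetchevSkinnerWan2017, Prop. 3.2.1] [cite: MilneADT2006, Ch. I, Thm. 4.10(b)] -/
theorem exists_uniform_nsmul_mem_selmerGroup_of_local (hrank : W.mordellWeilRank = 1) :
    ∃ N : ℕ, N ≠ 0 ∧ ∀ (k : ℕ) (c : galH1Torsion W ((p : ℤ) ^ (k + 1))),
      (∀ v : HeightOneSpectrum (𝓞 ℚ), v ≠ primePlace p →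
          c ∈ selmerLocalKer W (v.adicCompletion ℚ) ((p : ℤ) ^ (k + 1))) →
        (∀ w : InfinitePlace ℚ, c ∈ selmerLocalKer W w.Completion ((p : ℤ) ^ (k + 1))) →
          N • c ∈ selmerGroup W ((p : ℤ) ^ (k + 1)) := by
  have hp : p.Prime := Fact.out
  obtain ⟨N, hN0, hN⟩ := exists_uniform_nsmul_mem_selmerGroup_of_mem_kummerOutside W p hrank
  refine ⟨N, hN0, fun k => ?_⟩
  haveI : NeZero (p ^ (k + 1)) := ⟨pow_ne_zero _ hp.ne_zero⟩
  have key : ∀ (n : ℤ), n = ((p ^ (k + 1) : ℕ) : ℤ) → ∀ c : galH1Torsion W n,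
      (∀ v : HeightOneSpectrum (𝓞 ℚ), v ≠ primePlace p → c ∈ selmerLocalKer W (v.adicCompletion ℚ) n) →
        (∀ w : InfinitePlace ℚ, c ∈ selmerLocalKer W w.Completion n) → N • c ∈ selmerGroup W n := by
    rintro n rfl c h1 h2
    refine hN k c ((mem_kummerOutside_iff W (p ^ (k + 1)) _ c).mpr fun v hv => ?_)
    rw [← AddSubgroup.mem_comap, WeierstrassCurve.comap_res_kummerLocalConditionAt]
    rcases v with w | v
    · rw [WeierstrassCurve.selmerLocalKer_completion_inl]
      exact h2 w
    · have hvp : v ≠ primePlace p := fun h => hv (by rw [h, Finset.mem_singleton])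
      rw [WeierstrassCurve.selmerLocalKer_completion_inr]
      exact h1 v hvp
  exact key _ (by push_cast; ring)

end Local

/-! ## §4 (R1): `rank_{ℤ_p} H¹(ℤ[1/p], T_pW) ≤ 1` in rank one with `Ш[p^∞]` finite -/

section RankOne

variable (W : WeierstrassCurve ℚ) [W.IsElliptic] (p : ℕ) [Fact p.Prime]
  [ContinuousSMul ℤ_[p] (W.tateModule p)]

/-- Divisibility is total in `ℤ_p` (a valuation ring). [folklore] -/
private theorem padicInt_dvd_or_dvd (x y : ℤ_[p]) : x ∣ y ∨ y ∣ x := by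
  rcases ValuationRing.dvd_total x y with h | h
  · exact Or.inl h
  · exact Or.inr h

/-- `red_{p^k} (μ • z) = (appr μ k) • red_{p^k} z`: a `p`-adic integer acts on the reduction modulo `p^k`
through its `k`-th digit approximation (`μ − appr μ k ∈ p^k ℤ_p` and `red_{p^k}` kills `p^k`-multiples).
[cite: Kato2004Asterisque, §13.8 (p. 228)] -/
theorem reduceH1Pk_smul_eq_appr_nsmul (k : ℕ) (μ : ℤ_[p]) (z : H1 (tateRep W p) ⊤) :
    reduceH1Pk W p k ⊤ (μ • z) = PadicInt.appr μ k • reduceH1Pk W p k ⊤ z := by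
  obtain ⟨μ', hμ'⟩ := Ideal.mem_span_singleton'.mp (PadicInt.appr_spec k μ)
  have hμ : μ = ((PadicInt.appr μ k : ℕ) : ℤ_[p]) + (p : ℤ_[p]) ^ k * μ' := by
    rw [mul_comm, hμ']; ring
  calc reduceH1Pk W p k ⊤ (μ • z)
      = reduceH1Pk W p k ⊤ ((((PadicInt.appr μ k : ℕ) : ℤ_[p]) + (p : ℤ_[p]) ^ k * μ') • z) := by
        rw [← hμ]
    _ = reduceH1Pk W p k ⊤ (((PadicInt.appr μ k : ℕ) : ℤ_[p]) • z) +
          reduceH1Pk W p k ⊤ (((p : ℤ_[p]) ^ k) • (μ' • z)) := by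
        rw [add_smul, map_add, mul_smul]
    _ = PadicInt.appr μ k • reduceH1Pk W p k ⊤ z := by
        rw [reduceH1Pk_pow_smul, add_zero, Nat.cast_smul_eq_nsmul, map_nsmul]

/-- `red_{p^{k+1}} z = 0 ⟹ red_{p^k} z = 0` (the reductions are compatible under `p• : W[p^{k+1}] → W[p^k]`).
[cite: PerrinRiou1987BSMF, §0 (p. 401)] [cite: Kato2004Asterisque, §13.8 (p. 228)] -/
theorem reduceH1Pk_eq_zero_of_succ (k : ℕ) (z : H1 (tateRep W p) ⊤)
    (hz : reduceH1Pk W p (k + 1) ⊤ z = 0) : reduceH1Pk W p k ⊤ z = 0 := by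
  rw [← mapH1AddHom_reduceH1Pk_succ W p k ⊤ (W.geomTorsionReduce p k) (W.coe_geomTorsionReduce p k) z,
    hz, map_zero]

/-- **(R1) for `H¹(Γ_ℚ, T_pW)`: any two integral classes are `ℤ_p`-linearly dependent** when
`rank_ℤ W(ℚ) = 1` and `Ш(W)[p^∞]` is finite.  At every level `p^{k+1}` the reductions of `M • x`, `M • y`
(`M` = the product of the uniform exponents of §§1–3) are INTEGER multiples `a_k • κ(P₁)`, `b_k • κ(P₁)`
of one Kummer class; since divisibility is total in `ℤ_p`, one reduction is a `ℤ_p`-multiple of the other;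
the sets of admissible multipliers are closed and decrease with `k`, so compactness of `ℤ_p` yields ONE
`μ` with all reductions of `M•y − μ•M•x` (or of `M•x − μ•M•y`) zero, i.e. the class itself is zero
(`eq_zero_of_forall_reduceH1Pk_eq_zero`, Rubin App. B Prop. B.2.3).
[cite: Rubin2000, App. B Prop. B.2.3] [cite: Kato2004Asterisque, §14.14 (14.14.1) (p. 243) and §8.2] -/
theorem exists_smul_add_smul_eq_zero_of_mem_integralH1 (hrank : W.mordellWeilRank = 1)
    [Finite (AddCommGroup.primaryComponent W.sha p)]
    (x y : H1 (tateRep W p) ⊤) (hx : x ∈ integralH1 (tateRep W p) p ⊤)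
    (hy : y ∈ integralH1 (tateRep W p) p ⊤) :
    ∃ a b : ℤ_[p], (a ≠ 0 ∨ b ≠ 0) ∧ a • x + b • y = 0 := by
  have hp : p.Prime := Fact.out
  -- the three uniform exponents
  obtain ⟨T, hT0, hT⟩ := exists_uniform_nsmul_reduction_mem_selmerLocalKer W p
  obtain ⟨N, hN0, hN⟩ := exists_uniform_nsmul_mem_selmerGroup_of_local W p hrank
  obtain ⟨B, P₁, hB0, hB⟩ := exists_uniform_nsmul_eq_zsmul_kummerMapTorsion W p hrank
  set M : ℕ := B * (N * T) with hM
  have hM0 : M ≠ 0 := Nat.mul_ne_zero hB0 (Nat.mul_ne_zero hN0 hT0)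
  have hMp : (M : ℤ_[p]) ≠ 0 := Nat.cast_ne_zero.mpr hM0
  -- levelwise: the reductions of `M • z` are integer multiples of `κ_{p^{k+1}}(P₁)`
  have hdiv : ∀ k : ℕ, ∀ P : geomPoints W, ∃ Q : geomPoints W, ((p : ℤ) ^ (k + 1)) • Q = P :=
    fun k P => W.zsmul_geomPoints_surjective_holds
      (pow_ne_zero _ (Int.natCast_ne_zero.mpr hp.ne_zero)) P
  have hmult : ∀ (z : H1 (tateRep W p) ⊤), z ∈ integralH1 (tateRep W p) p ⊤ → ∀ k : ℕ, ∃ a : ℤ,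
      (ofTopSubgroup (W.torsionGaloisModule ((p : ℤ) ^ (k + 1))).toTopRep 1).hom
          (reduceH1Pk W p (k + 1) ⊤ (M • z)) =
        a • kummerMapTorsion W ((p : ℤ) ^ (k + 1)) (hdiv k) P₁ := by
    intro z hz k
    obtain ⟨h1, h2⟩ := hT z hz (k + 1)
    have hsel := hN k _ h1 h2
    obtain ⟨a, ha⟩ := hB ((p : ℤ) ^ (k + 1)) (hdiv k) ⟨k + 1, rfl⟩ _ hsel
    refine ⟨a, ?_⟩
    rw [← ha, map_nsmul, map_nsmul, hM, mul_nsmul', mul_nsmul']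
    rfl
  choose ax hax using hmult x hx
  choose ay hay using hmult y hy
  -- `p^{k+1}` kills `H¹(ℚ, W[p^{k+1}])`
  have hkill : ∀ (k : ℕ) (g : galH1Torsion W ((p : ℤ) ^ (k + 1))), ((p : ℤ) ^ (k + 1)) • g = 0 := by
    intro k g
    have h := nsmul_galH1Torsion_natCast_eq_zero W (p ^ (k + 1))
    rw [Nat.cast_pow] at h
    have h' : ((p ^ (k + 1) : ℕ) : ℤ) • g = 0 := by rw [natCast_zsmul]; exact h g
    rwa [Nat.cast_pow] at h'
  -- the admissible multipliers at level `k+1`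
  set MX : H1 (tateRep W p) ⊤ := M • x with hMX
  set MY : H1 (tateRep W p) ⊤ := M • y with hMY
  set Λ₁ : ℕ → Set ℤ_[p] := fun k => {μ | reduceH1Pk W p (k + 1) ⊤ (MY - μ • MX) = 0} with hΛ₁
  set Λ₂ : ℕ → Set ℤ_[p] := fun k => {μ | reduceH1Pk W p (k + 1) ⊤ (MX - μ • MY) = 0} with hΛ₂
  -- (F1) dichotomy at each level
  have step : ∀ (k : ℕ) (u w : H1 (tateRep W p) ⊤) (a b : ℤ),
      (ofTopSubgroup (W.torsionGaloisModule ((p : ℤ) ^ (k + 1))).toTopRep 1).hom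
          (reduceH1Pk W p (k + 1) ⊤ u) = a • kummerMapTorsion W ((p : ℤ) ^ (k + 1)) (hdiv k) P₁ →
      (ofTopSubgroup (W.torsionGaloisModule ((p : ℤ) ^ (k + 1))).toTopRep 1).hom
          (reduceH1Pk W p (k + 1) ⊤ w) = b • kummerMapTorsion W ((p : ℤ) ^ (k + 1)) (hdiv k) P₁ →
      ∀ μ : ℤ_[p], (b : ℤ_[p]) = a * μ → reduceH1Pk W p (k + 1) ⊤ (w - μ • u) = 0 := by
    intro k u w a b hu hw μ hμ
    apply eq_zero_of_ofTopSubgroup_eq_zero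
    rw [map_sub, reduceH1Pk_smul_eq_appr_nsmul, map_sub, map_nsmul, hu, hw]
    -- `b - ℓ a` is divisible by `p^{k+1}` (`ℓ` the `(k+1)`-st digit approximation of `μ`)
    have hd : ((p : ℤ) ^ (k + 1)) ∣ (b - (PadicInt.appr μ (k + 1) : ℤ) * a) := by
      rw [← PadicInt.pow_p_dvd_int_iff]
      obtain ⟨μ', hμ'⟩ := Ideal.mem_span_singleton'.mp (PadicInt.appr_spec (k + 1) μ)
      refine ⟨(a : ℤ_[p]) * μ', ?_⟩
      push_cast
      rw [hμ]
      linear_combination (-(a : ℤ_[p])) * hμ'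
    obtain ⟨q, hq⟩ := hd
    have e : PadicInt.appr μ (k + 1) • (a • kummerMapTorsion W ((p : ℤ) ^ (k + 1)) (hdiv k) P₁) =
        ((PadicInt.appr μ (k + 1) : ℤ) * a) • kummerMapTorsion W ((p : ℤ) ^ (k + 1)) (hdiv k) P₁ := by
      rw [mul_zsmul, natCast_zsmul]
    have h0 : (b - (PadicInt.appr μ (k + 1) : ℤ) * a) • kummerMapTorsion W ((p : ℤ) ^ (k + 1)) (hdiv k) P₁ = 0 := by
      rw [hq, mul_comm, mul_zsmul, hkill k, zsmul_zero]
    have key : b • kummerMapTorsion W ((p : ℤ) ^ (k + 1)) (hdiv k) P₁ =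
        PadicInt.appr μ (k + 1) • (a • kummerMapTorsion W ((p : ℤ) ^ (k + 1)) (hdiv k) P₁) := by
      rw [e, ← sub_add_cancel b ((PadicInt.appr μ (k + 1) : ℤ) * a), add_zsmul, h0, zero_add]
    exact sub_eq_zero.mpr key
  have hF1 : ∀ k, (Λ₁ k).Nonempty ∨ (Λ₂ k).Nonempty := by
    intro k
    rcases padicInt_dvd_or_dvd p (ax k : ℤ_[p]) (ay k : ℤ_[p]) with ⟨μ, hμ⟩ | ⟨μ, hμ⟩
    · exact Or.inl ⟨μ, step k MX MY (ax k) (ay k) (hax k) (hay k) μ hμ⟩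
    · exact Or.inr ⟨μ, step k MY MX (ay k) (ax k) (hay k) (hax k) μ hμ⟩
  -- (F2) the sets decrease
  have hF2₁ : ∀ k, Λ₁ (k + 1) ⊆ Λ₁ k := fun k μ hμ => reduceH1Pk_eq_zero_of_succ W p _ _ hμ
  have hF2₂ : ∀ k, Λ₂ (k + 1) ⊆ Λ₂ k := fun k μ hμ => reduceH1Pk_eq_zero_of_succ W p _ _ hμ
  -- (F3) the sets are closed: membership depends only on `μ mod p^{k+1}`
  have hclosed : ∀ (k : ℕ) (u w : H1 (tateRep W p) ⊤),
      IsClosed {μ : ℤ_[p] | reduceH1Pk W p (k + 1) ⊤ (w - μ • u) = 0} := by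
    intro k u w
    refine isClosed_of_closure_subset fun μ hμ => ?_
    have hε : (0 : ℝ) < (p : ℝ) ^ (-(k + 1 : ℕ) : ℤ) := zpow_pos (by exact_mod_cast hp.pos) _
    obtain ⟨μ₀, hμ₀, hdist⟩ := Metric.mem_closure_iff.mp hμ _ hε
    have hmem : μ - μ₀ ∈ Ideal.span {(p : ℤ_[p]) ^ (k + 1)} := by
      rw [← PadicInt.norm_le_pow_iff_mem_span_pow]
      rw [dist_eq_norm] at hdist
      exact hdist.le
    obtain ⟨ν, hν⟩ := Ideal.mem_span_singleton'.mp hmem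
    have hμeq : μ = μ₀ + (p : ℤ_[p]) ^ (k + 1) * ν := by rw [mul_comm, hν]; ring
    show reduceH1Pk W p (k + 1) ⊤ (w - μ • u) = 0
    have h0 : reduceH1Pk W p (k + 1) ⊤ (w - μ₀ • u) = 0 := hμ₀
    rw [hμeq, add_smul, ← sub_sub, map_sub, h0, mul_smul, reduceH1Pk_pow_smul, sub_zero]
  -- (F4) one of the two families is non-empty at every level
  have hanti₁ : Antitone Λ₁ := antitone_nat_of_succ_le hF2₁
  have hanti₂ : Antitone Λ₂ := antitone_nat_of_succ_le hF2₂
  have hF4 : (∀ k, (Λ₁ k).Nonempty) ∨ (∀ k, (Λ₂ k).Nonempty) := by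
    by_cases h : ∀ k, (Λ₁ k).Nonempty
    · exact Or.inl h
    · obtain ⟨k₀, hk₀⟩ := not_forall.mp h
      refine Or.inr fun k => ?_
      have hK : ¬ (Λ₁ (max k k₀)).Nonempty := fun hne =>
        hk₀ (hne.mono (hanti₁ (le_max_right k k₀)))
      rcases hF1 (max k k₀) with h1 | h2
      · exact absurd h1 hK
      · exact h2.mono (hanti₂ (le_max_left k k₀))
  -- (F5) compactness of `ℤ_p` and Rubin's injectivity into the product of the levels
  have conclude : ∀ (u w : H1 (tateRep W p) ⊤) (Λ : ℕ → Set ℤ_[p]),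
      (∀ k, Λ k = {μ : ℤ_[p] | reduceH1Pk W p (k + 1) ⊤ (w - μ • u) = 0}) →
      (∀ k, Λ (k + 1) ⊆ Λ k) → (∀ k, (Λ k).Nonempty) → ∃ μ : ℤ_[p], w - μ • u = 0 := by
    intro u w Λ hΛ hdec hne
    have hcl : ∀ k, IsClosed (Λ k) := fun k => by rw [hΛ k]; exact hclosed k u w
    obtain ⟨μ, hμ⟩ := IsCompact.nonempty_iInter_of_sequence_nonempty_isCompact_isClosed Λ hdec hne
      (hcl 0).isCompact hcl
    refine ⟨μ, eq_zero_of_forall_reduceH1Pk_eq_zero W p ⊤ _ fun j => ?_⟩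
    have hall : ∀ k, reduceH1Pk W p (k + 1) ⊤ (w - μ • u) = 0 := fun k => by
      have h := Set.mem_iInter.mp hμ k
      rw [hΛ k] at h
      exact h
    cases j with
    | zero => exact reduceH1Pk_eq_zero_of_succ W p 0 _ (hall 0)
    | succ j => exact hall j
  rcases hF4 with h | h
  · obtain ⟨μ, hμ⟩ := conclude MX MY Λ₁ (fun k => rfl) hF2₁ h
    refine ⟨-(μ * (M : ℤ_[p])), (M : ℤ_[p]), Or.inr hMp, ?_⟩
    have e : (M : ℤ_[p]) • y = μ • ((M : ℤ_[p]) • x) := by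
      rw [Nat.cast_smul_eq_nsmul, Nat.cast_smul_eq_nsmul]
      exact sub_eq_zero.mp hμ
    rw [neg_smul, mul_smul, e, neg_add_cancel]
  · obtain ⟨μ, hμ⟩ := conclude MY MX Λ₂ (fun k => rfl) hF2₂ h
    refine ⟨(M : ℤ_[p]), -(μ * (M : ℤ_[p])), Or.inl hMp, ?_⟩
    have e : (M : ℤ_[p]) • x = μ • ((M : ℤ_[p]) • y) := by
      rw [Nat.cast_smul_eq_nsmul, Nat.cast_smul_eq_nsmul]
      exact sub_eq_zero.mp hμ
    rw [neg_smul, mul_smul, e, add_neg_cancel]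

/-- **(R1) at the top subgroup: `rank_{ℤ_p} H¹(ℤ[1/p], T_pW) ≤ 1`** (the tree's `Kato2004.integralH1 … ⊤`)
when `rank_ℤ W(ℚ) = 1` and `Ш(W)[p^∞]` is finite: every pair of integral classes is linearly dependent
(`exists_smul_add_smul_eq_zero_of_mem_integralH1`), so no linearly independent family has two members
(Mathlib `rank_le`). [cite: Kato2004Asterisque, §14.9 (14.9.3) (p. 240) and 14.13 (p. 243)] -/
theorem rank_integralH1_top_le_one (hrank : W.mordellWeilRank = 1)
    [Finite (AddCommGroup.primaryComponent W.sha p)] :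
    Module.rank ℤ_[p] (integralH1 (tateRep W p) p ⊤) ≤ 1 := by
  classical
  refine rank_le fun s hs => ?_
  by_contra hlt
  push Not at hlt
  obtain ⟨x, hx, y, hy, hxy⟩ := Finset.one_lt_card.mp hlt
  obtain ⟨a, b, hab, hrel⟩ :=
    exists_smul_add_smul_eq_zero_of_mem_integralH1 W p hrank (x : H1 (tateRep W p) ⊤) (y : H1 (tateRep W p) ⊤)
      x.2 y.2
  let f : Fin 2 → ↥s := ![⟨x, hx⟩, ⟨y, hy⟩]
  have hf : Function.Injective f := by
    intro i j hij
    fin_cases i <;> fin_cases j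
    · rfl
    · exact absurd (congrArg (fun z : ↥s => (z : integralH1 (tateRep W p) p ⊤)) hij) hxy
    · exact absurd (congrArg (fun z : ↥s => (z : integralH1 (tateRep W p) p ⊤)) hij).symm hxy
    · rfl
  have hli := hs.comp f hf
  have hsum : ∑ i : Fin 2, (![a, b] i) • ((fun i : ↥s => (i : integralH1 (tateRep W p) p ⊤)) ∘ f) i = 0 := by
    rw [Fin.sum_univ_two]
    apply Subtype.ext
    change ((a • x + b • y : integralH1 (tateRep W p) p ⊤) : H1 (tateRep W p) ⊤) = 0
    push_cast
    exact hrel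
  have h0 := Fintype.linearIndependent_iff.mp hli ![a, b] hsum
  rcases hab with ha | hb
  · exact ha (by simpa using h0 0)
  · exact hb (by simpa using h0 1)

/-- **(R1) at the bottom layer of a `ℤ_p`-extension** (the shape of the hypothesis of
`Kato2004.finite_descentCokernel_of_rankOne_of_rank_le_one`): `rank_{ℤ_p} H¹(ℤ[1/p], T_pW) ≤ 1` for
`integralH1 … (κ.layerSubgroup 0)`, by the injective `ℤ_p`-linear map `layerZeroToTop` into the `⊤`
version. [cite: Kato2004Asterisque, §14.9 (14.9.3) (p. 240) and 14.13 (p. 243)] -/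
theorem rank_integralH1_layerZero_le_one (κ : ZpExtension ℚ p) (hrank : W.mordellWeilRank = 1)
    [Finite (AddCommGroup.primaryComponent W.sha p)] :
    Module.rank ℤ_[p] (integralH1 (tateRep W p) p (κ.layerSubgroup 0)) ≤ 1 := by
  let f : integralH1 (tateRep W p) p (κ.layerSubgroup 0) →ₗ[ℤ_[p]] integralH1 (tateRep W p) p ⊤ :=
    { toFun := fun x ↦ ⟨layerZeroToTop W p κ (x : H1 (tateRep W p) (κ.layerSubgroup 0)),
        layerZeroToTop_mem_integralH1 W p κ x.2⟩
      map_add' := fun x y ↦ Subtype.ext (by simp only [Submodule.coe_add, map_add])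
      map_smul' := fun a x ↦ Subtype.ext (by
        simp only [Submodule.coe_smul, RingHom.id_apply]
        exact layerZeroToTop_smul W p κ a x) }
  have hf : Function.Injective f := fun x y hxy ↦ by
    have h : layerZeroToTop W p κ (x : H1 (tateRep W p) (κ.layerSubgroup 0)) =
        layerZeroToTop W p κ (y : H1 (tateRep W p) (κ.layerSubgroup 0)) := congrArg Subtype.val hxy
    refine Subtype.ext ?_
    rw [← sub_eq_zero] at h ⊢
    rw [← map_sub] at h
    exact eq_zero_of_layerZeroToTop_eq_zero W p κ _ h
  exact (LinearMap.rank_le_of_injective f hf).trans (rank_integralH1_top_le_one W p hrank)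

end RankOne

/-! ## §5 The RI conjunct `finite_descentCokernel_of_rankOne` from (α) and Thm. 12.4 (2) -/

section Corollary

/-- **The 9th RI conjunct of the registered `kato-zeta-perrin-riou` v1e lines REDUCED TO THE OTHER TWO
Kato conjuncts**: `Kato2004.finite_descentCokernel_of_rankOne` ⟸ `Kato2004.nonempty_iwasawaH2Data`
((14.14.1)-injectivity on the pin) ∧ `Kato2004.thm12_4` (only (12.2.1) + Thm. 12.4 (2) are used) —
(R1) being the theorem `rank_integralH1_layerZero_le_one` of §4 and the reduction the seat's Literature
theorem `Kato2004.finite_descentCokernel_of_rankOne_of_rank_le_one` (p501874).  Conditional: the two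
hypotheses are citation-borne conjuncts of the same stub; nothing else is assumed.
[cite: Kato2004Asterisque, §14.14 (14.14.1) (p. 243), Thm. 12.4 (2) (p. 221), §14.9 (14.9.3) (p. 240)] -/
theorem finite_descentCokernel_of_rankOne_of_nonempty_of_thm12_4 (h2 : nonempty_iwasawaH2Data)
    (h12 : thm12_4) : finite_descentCokernel_of_rankOne :=
  finite_descentCokernel_of_rankOne_of_rank_le_one h2 h12 fun W _ p _ _ κ hrank hsha => by
    haveI := hsha
    exact rank_integralH1_layerZero_le_one W p κ hrank

/-- The same with (α) in the door shape `∀ W p κ γ, κ.IsCyclotomic → κ.IsTopGenerator γ → ∀ I x,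
I.proj 0 x = 0 → x ∈ T·𝐇¹_Γ` (the form being proved in the tree): (α) ∧ `thm12_4` ⟹
`finite_descentCokernel_of_rankOne`. [cite: Kato2004Asterisque, §14.14 (14.14.1) (p. 243), Thm. 12.4 (2) (p. 221)] -/
theorem finite_descentCokernel_of_rankOne_of_forall_isTopGenerator_of_thm12_4
    (hα : ∀ (W : WeierstrassCurve ℚ) [W.IsElliptic] (p : ℕ) [Fact p.Prime]
      [ContinuousSMul ℤ_[p] (W.tateModule p)] (κ : ZpExtension ℚ p) (γ : absoluteGaloisGroup ℚ),
      κ.IsCyclotomic → κ.IsTopGenerator γ → ∀ (I : IwasawaH1Data W p κ γ) (x : I.H),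
        I.proj 0 x = 0 → x ∈ IwasawaAlgebra.TSubmodule p I.H)
    (h12 : thm12_4) : finite_descentCokernel_of_rankOne :=
  finite_descentCokernel_of_rankOne_of_nonempty_of_thm12_4
    (nonempty_iwasawaH2Data_of_forall_isTopGenerator hα) h12

end Corollary

end Summit.BirchSwinnertonDyer.BirchSwinnertonDyer.Theorems.CongruentShaFreeCutIntegralH1RankLeOne

end
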